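import Literature.AlgebraicGeometry.Modules.TensorSheafHomIso
import Literature.AlgebraicGeometry.Modules.SheafHomCoh
import Literature.AlgebraicGeometry.Modules.SheafHomFrames
import Literature.AlgebraicGeometry.Morphisms.CohOfVectorBundle
import HarnessLib

/-!
# `L ⊗ M` is quasi-coherent / coherent for `L` finite locally free (any universe, locally noetherian scheme)

Layer `Literature/AlgebraicGeometry/Modules` (0 definitions, 0 named facts, no instances). For a finite locally free
`𝒪_X`-module `L` on a locally noetherian scheme `X` and an `𝒪_X`-module `M`, `L ⊗ M ≅ 𝓗om(L^∨, M)`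
(`Modules/TensorSheafHomIso.tensorSheafHomDualIso`, Hartshorne II Ex. 5.1 (b)); since the dual `L^∨` is finite locally
free (`Modules/SheafHomFrames.isFiniteLocallyFree_dual`), hence coherent (`Morphisms/CohOfVectorBundle.coh_of_isVectorBundle`),
and `𝓗om` of a coherent source into a quasi-coherent (resp. coherent) target is quasi-coherent (resp. coherent)
(`Modules/SheafHomCoh.isAffineLocalizing_sheafHom ∕ coh_sheafHom`, GW I Prop. 7.29), the tensor product `L ⊗ M` is
quasi-coherent (affine-localizing) for `M` quasi-coherent and COHERENT for `M` coherent.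

This is the universe-general form (`X : Scheme.{u}`) of the tree's `Scheme.{0}` lemmas
`AbelianVarieties/MarkmanKernelTransformDescent.isAffineLocalizing_tensorObj_of_isFiniteLocallyFree` and
`AbelianVarieties/MarkmanDescendedTransformCoh.coh_tensorObj_of_isFiniteLocallyFree` (same three-line proof), placed in
`Modules/` so that module-level consumers (e.g. the `K₀(X)`-module structure on `K(X)`, `KTheory/CoherentGrothendieckGroupModule`)
need not import the abelian-variety layer.

## References

* R. Hartshorne, *Algebraic Geometry*, GTM 52 (1977), II Ex. 5.1 (b) (p. 123), II Prop. 5.7 (p. 114). [Hartshorne1977]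
* U. Görtz, T. Wedhorn, *Algebraic Geometry I*, 2nd ed. (2020), Prop. 7.29. [GortzWedhorn2020]
-/

noncomputable section

universe u

open CategoryTheory AlgebraicGeometry
open Literature.AlgebraicGeometry.Motives Literature.AlgebraicGeometry.Modules

namespace Literature.AlgebraicGeometry.Morphisms

variable {X : Scheme.{u}} [IsLocallyNoetherian X] {L M : X.Modules}

/-- **`L ⊗ M` is quasi-coherent (affine-localizing) for `L` finite locally free and `M` quasi-coherent** on a
locally noetherian scheme, in any universe: `L ⊗ M ≅ 𝓗om(L^∨, M)` with `L^∨` coherent. Universe-general form of the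
tree's `Scheme.{0}` lemma `isAffineLocalizing_tensorObj_of_isFiniteLocallyFree` (`AbelianVarieties/MarkmanKernelTransformDescent`).
[cite: Hartshorne1977, II Ex. 5.1 (b) (p. 123) and Prop. 5.7 (p. 114)] -/
theorem IsAffineLocalizing.tensorObj_of_isFiniteLocallyFree (hL : IsFiniteLocallyFree L) (hM : IsAffineLocalizing M) :
    IsAffineLocalizing (tensorObj L M) := by
  have hLd := coh_of_isVectorBundle (isFiniteLocallyFree_dual hL).isVectorBundle
  exact IsAffineLocalizing.of_iso (tensorSheafHomDualIso L M hL).symm (isAffineLocalizing_sheafHom hLd.loc hLd.ft hM)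

/-- **`L ⊗ M` is coherent for `L` finite locally free and `M` coherent** on a locally noetherian scheme, in any
universe: `L ⊗ M ≅ 𝓗om(L^∨, M)` and `𝓗om` of coherent modules is coherent (`coh_sheafHom`). Universe-general form of
the tree's `Scheme.{0}` lemma `coh_tensorObj_of_isFiniteLocallyFree` (`AbelianVarieties/MarkmanDescendedTransformCoh`).
[cite: Hartshorne1977, II Ex. 5.1 (b) (p. 123) and Prop. 5.7 (p. 114)] -/
theorem Coh.tensorObj_of_isFiniteLocallyFree (hL : IsFiniteLocallyFree L) (hM : Coh M) : Coh (tensorObj L M) := by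
  have h := coh_sheafHom (coh_of_isVectorBundle (isFiniteLocallyFree_dual hL).isVectorBundle) hM
  exact ⟨IsAffineLocalizing.of_iso (tensorSheafHomDualIso L M hL).symm h.loc,
    IsAffineFiniteType.of_iso (tensorSheafHomDualIso L M hL).symm h.ft⟩

/-- In particular `L ⊗ L'` is coherent for two finite locally free modules (locally noetherian `X`).
[cite: Hartshorne1977, II Ex. 5.1 (b) (p. 123) and Prop. 5.7 (p. 114)] -/
theorem Coh.tensorObj_of_isFiniteLocallyFree_of_isFiniteLocallyFree {L' : X.Modules} (hL : IsFiniteLocallyFree L)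
    (hL' : IsFiniteLocallyFree L') : Coh (tensorObj L L') :=
  Coh.tensorObj_of_isFiniteLocallyFree hL (coh_of_isVectorBundle hL'.isVectorBundle)

end Literature.AlgebraicGeometry.Morphisms

end
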